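import Mathlib
import HarnessLib
import Summits.NavierStokesRegularity.NavierStokesRegularity.Theorems.PoloidalWindowRigidity.Negative.CellField

/-!
# Crux `PoloidalWindowRigidity` (K2, stmt-NavierStokesRegularity-19708, route `PoloidalWindowDoor`) — the registered
# residue `stub_nonflatLiouville` with the Oseen-mild identity deleted is FALSE: a NON-FLAT, generic poloidal
# Type-I profile obeying the frozen constraint and singular at the apex

Negative-side support (refuter seat ns-regularity-refuter1, cell ns-regularity-ideate; D-0081 §C). The open residue of
K2 is the registered stub `stub_nonflatLiouville` (hypothesis `h₅` of
`…Theorems.PoloidalWindowDoorTarget.target_of_nonflatLiouville`): a profile `v : (−∞,0) × ℝ³ → ℝ³` with (R) the Type-I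
time rate, (C) continuity on the open slab, (M) the unit-viscosity Oseen-mild identity, (D) divergence-free slices,
(P) poloidal along `e₂` everywhere (`⟪curl v(s), e₂⟫ ≡ 0`), (F) the frozen constraint `⟪Dv(s)(y) curl v(s)(y), e₂⟫ ≡ 0`
(`v·e₂` is a first integral of the vortex lines) and (N) non-flat (`∂₀ v₂ ≠ 0` somewhere) is not backward-singular at
the apex.

`stub_nonflatLiouville_false_without_mild`: delete (M) and the statement is FALSE. The companion file
`…Negative.FalseWithoutMild` kills K2-without-(M) by the curl-free parasitic drift, which is FLAT; here the witness is
the separated CELLULAR profile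

  `v(t, x) = (−t)^{-1/2} V(x)`,  `V(x) = (cos x₂ cos x₀, cos x₂ cos x₁, sin x₂ (sin x₀ + sin x₁))`

(`cellProfile`, `cellField`; indices `0,1,2` as in Lean). `V` is the instance `A = cos x₂`, `P = sin x₀ + sin x₁` of
the kinematic family `V = (A(x₂) ∂₀P, A(x₂) ∂₁P, B(x₂) P)` with `ΔₕP = −P`, `B′ = A` (here `B = sin x₂`): for every
member `div V = A ΔₕP + B′P = 0`, `curl V = ((B + A′)∂₁P, −(B + A′)∂₀P, 0)` is horizontal, and
`curl V · ∇V₂ = (B + A′)B (∂₁P ∂₀P − ∂₀P ∂₁P) = 0`. Kernel-checked below for the instance: `div V = 0`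
(`isDivFree_cellProfile`), `curl V = (2 sin x₂ cos x₁, −2 sin x₂ cos x₀, 0)` (`curl_cellField`) — so (P) holds — and
`DV · curl V` has vanishing `e₂`-component (`frozen_cellProfile`) — so (F) holds. The profile has the Type-I rate with
constant `4`, is continuous on the slab, is non-flat (`∂₀V₂(0,0,π/2) = 1`), is NOT vertically rigid
(`(DV e₂)₀(0,0,π/2) = −1`), `V₂` is flat in NO horizontal direction, it is not scale-invariant, and it is
backward-singular at the apex (`‖v(t,y)‖ ≥ ¼(−t)^{-1/2}` on `‖y‖ < 1`). It is `2π`-periodic in every coordinate and has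
no continuous spatial symmetry (informal remark; not needed below).

CONSEQUENCE for the K2 line (lead's census): the kinematic part of the residue class — {(R),(C),(D),(P),(F),(N)} plus
the generic exclusions of the reshaped stub checked here (not vertically rigid, flat in no horizontal direction, not
scale-invariant) — is inhabited by singular profiles; all rigidity must come from the dynamics (M), used beyond slice
regularity and beyond the flat / parasitic mechanism.

WHAT THIS IS NOT: not a claim about Navier–Stokes regularity and not a refutation of K2 or of its stub — a
kernel-checked certificate that hypothesis (M) of the stub cannot be dropped even on the non-flat, generic stratum.
-/

noncomputable section

-- the summit and its single sub-problem share the name (CONVENTIONS §1), as in every Theorems file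
set_option linter.dupNamespace false

namespace Summit.NavierStokesRegularity.NavierStokesRegularity.Theorems.PoloidalWindowRigidity.Negative

open MeasureTheory Set Function Filter Topology Metric
open scoped RealInnerProductSpace InnerProductSpace ENNReal NNReal
open Literature.Analysis Literature.Analysis.FluidPDE

/-! ## Point evaluations, genericity, and the apex singularity of the cellular profile -/

/-- (N) non-flat: `∂₀ v₂(−1, (0,0,π/2)) = 1 ≠ 0`. [folklore] -/
theorem nonflat_cellProfile :
    fderiv ℝ (cellProfile (-1)) ((Real.pi / 2) • (EuclideanSpace.single 2 (1 : ℝ)))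
      (EuclideanSpace.single 0 (1 : ℝ)) 2 ≠ 0 := by
  rw [fderiv_cellProfile_apply, cellDeriv_apply_two]
  simp [cellAmp]

/-- Not vertically rigid: `(Dv(s) e₂)₀(0,0,π/2) = −(−s)^{-1/2} ≠ 0`. [folklore] -/
theorem not_vertRigid_cellProfile {s : ℝ} (hs : s < 0) :
    fderiv ℝ (cellProfile s) ((Real.pi / 2) • (EuclideanSpace.single 2 (1 : ℝ)))
      (EuclideanSpace.single 2 (1 : ℝ)) 0 ≠ 0 := by
  rw [fderiv_cellProfile_apply, cellDeriv_apply_zero]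
  simp [(cellAmp_pos hs).ne']

/-- `v·e₂` is flat in NO horizontal direction: for `a ≠ 0`, `a ⊥ e₂`, `⟪Dv(s)(y) a, e₂⟫ ≠ 0` at `y = (0,0,π/2)` or at
`y = (π,0,π/2)`. [folklore] -/
theorem flat_in_no_horizontal_direction_cellProfile {s : ℝ} (hs : s < 0) (a : EuclideanSpace ℝ (Fin 3))
    (ha : a ≠ 0) (ha2 : ⟪a, (EuclideanSpace.single 2 (1 : ℝ))⟫_ℝ = 0) :
    ∃ y : EuclideanSpace ℝ (Fin 3),
      ⟪fderiv ℝ (cellProfile s) y a, (EuclideanSpace.single 2 (1 : ℝ))⟫_ℝ ≠ 0 := by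
  have ha2' : a 2 = 0 := by simpa [EuclideanSpace.inner_single_right] using ha2
  by_contra hcon
  simp only [not_exists, ne_eq, not_not] at hcon
  have key : ∀ y : EuclideanSpace ℝ (Fin 3),
      cellAmp s * (Real.sin (y 2) * (Real.cos (y 0) * a 0 + Real.cos (y 1) * a 1) +
        (Real.sin (y 0) + Real.sin (y 1)) * (Real.cos (y 2) * a 2)) = 0 := by
    intro y
    have := hcon y
    rw [EuclideanSpace.inner_single_right, fderiv_cellProfile_apply, cellDeriv_apply_two] at this
    simpa using this
  have hA := key ((Real.pi / 2) • (EuclideanSpace.single 2 (1 : ℝ)))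
  have hB := key (Real.pi • (EuclideanSpace.single 0 (1 : ℝ)) +
    (Real.pi / 2) • (EuclideanSpace.single 2 (1 : ℝ)))
  simp [ha2'] at hA hB
  have hamp := (cellAmp_pos hs).ne'
  have h0 : a 0 + a 1 = 0 := by
    rcases hA with h | h
    · exact absurd h hamp
    · linarith
  have h1 : -a 0 + a 1 = 0 := by
    rcases hB with h | h
    · exact absurd h hamp
    · linarith
  apply ha
  ext i
  fin_cases i
  · show a 0 = 0; linarith
  · show a 1 = 0; linarith
  · show a 2 = 0; exact ha2'

/-- Not scale-invariant: `λ v(λ² s, λ y) ≠ v(s, y)` for `λ = 2`, `s = −1`, `y = (π/2, 0, 0)` (first components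
`−2(−4s)^{-1/2}` vs `0`). [folklore] -/
theorem not_scaleInvariant_cellProfile :
    (2 : ℝ) • cellProfile ((2 : ℝ) ^ 2 * (-1))
        ((2 : ℝ) • ((Real.pi / 2) • (EuclideanSpace.single 0 (1 : ℝ)))) ≠
      cellProfile (-1) ((Real.pi / 2) • (EuclideanSpace.single 0 (1 : ℝ))) := by
  intro h
  have hy : ((2 : ℝ) • ((Real.pi / 2) • (EuclideanSpace.single 0 (1 : ℝ))) : EuclideanSpace ℝ (Fin 3)) =
      Real.pi • (EuclideanSpace.single 0 (1 : ℝ)) := by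
    rw [smul_smul]; congr 1; ring
  rw [hy] at h
  have h0 := congrArg (fun w : EuclideanSpace ℝ (Fin 3) => w 0) h
  simp [cellProfile, cellField_apply_zero] at h0
  exact (cellAmp_pos (by norm_num)).ne' h0

/-- **(S) the cellular profile is backward-singular at the apex**: on `‖y‖ < 1` one has `cos y₂ cos y₀ ≥ ¼`, so
`‖v(t, y)‖ ≥ |v₀(t, y)| ≥ ¼ (−t)^{-1/2}`, which exceeds every level on a set of positive measure inside every
parabolic cylinder `Q(0, r)`. [folklore] -/
theorem isBackwardSingularPoint_cellProfile : IsBackwardSingularPoint cellProfile 0 := by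
  intro r hr
  rw [eLpNorm_exponent_top]
  show essSup (fun z => ‖uncurry cellProfile z‖ₑ) _ = ⊤
  apply essSup_eq_top_of_forall_exists_lt
  intro N
  set K : ℝ := (N : ℝ) + 1 with hK
  have hKpos : 0 < K := by positivity
  set C : ℝ := 1 / 4 with hCdef
  have hC : 0 < C := by norm_num
  set τ : ℝ := min (r ^ 2) ((C / K) ^ 2) / 2 with hτ
  have hmin : 0 < min (r ^ 2) ((C / K) ^ 2) := lt_min (by positivity) (by positivity)
  have hτpos : 0 < τ := by positivity
  have hτr : τ < r ^ 2 := by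
    have := min_le_left (r ^ 2) ((C / K) ^ 2)
    rw [hτ]; linarith
  have hτK : τ < (C / K) ^ 2 := by
    have := min_le_right (r ^ 2) ((C / K) ^ 2)
    rw [hτ]; linarith
  set ρ : ℝ := min r 1 with hρ
  have hρpos : 0 < ρ := lt_min hr one_pos
  have hρr : ρ ≤ r := min_le_left _ _
  have hρ1 : ρ ≤ 1 := min_le_right _ _
  refine ⟨Ioo (-τ) 0 ×ˢ ball 0 ρ, ?_, ?_⟩
  · have hsub : Ioo (-τ) 0 ×ˢ ball (0 : EuclideanSpace ℝ (Fin 3)) ρ ⊆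
        parabolicCylinder r (0 : ℝ × EuclideanSpace ℝ (Fin 3)) := by
      rintro ⟨t, x⟩ ⟨⟨ht1, ht2⟩, hx⟩
      rw [mem_parabolicCylinder]
      refine ⟨⟨?_, ?_⟩, ?_⟩
      · simp only [Prod.fst_zero]; linarith
      · simpa using ht2
      · simp only [Prod.snd_zero]
        exact lt_of_lt_of_le (mem_ball.1 hx) hρr
    rw [Measure.restrict_apply (measurableSet_Ioo.prod measurableSet_ball),
      inter_eq_left.2 hsub, Measure.volume_eq_prod, Measure.prod_prod]
    refine mul_ne_zero ?_ (measure_ball_pos volume (0 : EuclideanSpace ℝ (Fin 3)) hρpos).ne'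
    rw [Real.volume_Ioo]
    simp [hτpos]
  · rintro ⟨t, y⟩ ⟨⟨ht1, ht2⟩, hy⟩
    simp only [uncurry_apply_pair]
    have hy1 : ‖y‖ < 1 := lt_of_lt_of_le (mem_ball_zero_iff.1 hy) hρ1
    have hpi3 : (1 : ℝ) ≤ Real.pi / 3 := by linarith [Real.pi_gt_three]
    have hcos : ∀ i : Fin 3, 1 / 2 ≤ Real.cos (y i) := by
      intro i
      have hyi : |y i| ≤ 1 := by
        have := PiLp.norm_apply_le y i
        rw [Real.norm_eq_abs] at this
        linarith
      rw [← Real.cos_abs, ← Real.cos_pi_div_three]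
      exact Real.cos_le_cos_of_nonneg_of_le_pi (abs_nonneg _) (by linarith [Real.pi_pos]) (hyi.trans hpi3)
    have hspos : 0 < Real.sqrt (-t) := Real.sqrt_pos.2 (by linarith)
    have hamp : cellAmp t = (Real.sqrt (-t))⁻¹ := rfl
    -- lower bound on the first component
    have hlow : C / Real.sqrt (-t) ≤ ‖cellProfile t y‖ := by
      have h0 : cellProfile t y 0 = cellAmp t * (Real.cos (y 2) * Real.cos (y 0)) := by
        simp only [cellProfile, PiLp.smul_apply, smul_eq_mul, cellField_apply_zero]
      have hprod : 1 / 4 ≤ Real.cos (y 2) * Real.cos (y 0) := by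
        have h2 := hcos 2
        have h0' := hcos 0
        nlinarith
      calc C / Real.sqrt (-t) = cellAmp t * C := by rw [hamp, div_eq_inv_mul]
        _ ≤ cellAmp t * (Real.cos (y 2) * Real.cos (y 0)) :=
            mul_le_mul_of_nonneg_left (by rw [hCdef]; exact hprod) (cellAmp_nonneg t)
        _ = |cellProfile t y 0| := by
            rw [h0, abs_of_nonneg (mul_nonneg (cellAmp_nonneg t) (by linarith))]
        _ = ‖cellProfile t y 0‖ := (Real.norm_eq_abs _).symm
        _ ≤ ‖cellProfile t y‖ := PiLp.norm_apply_le _ 0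
    rw [← ofReal_norm, show ((N : ℝ≥0) : ℝ≥0∞) = ENNReal.ofReal (N : ℝ) by simp]
    rw [ENNReal.ofReal_lt_ofReal_iff (lt_of_lt_of_le (div_pos hC hspos) hlow)]
    refine lt_of_lt_of_le ?_ hlow
    rw [lt_div_iff₀ hspos]
    have hst : Real.sqrt (-t) < C / K := by
      rw [Real.sqrt_lt' (div_pos hC hKpos)]
      linarith
    calc (N : ℝ) * Real.sqrt (-t) ≤ K * Real.sqrt (-t) :=
          mul_le_mul_of_nonneg_right (by rw [hK]; linarith) hspos.le
      _ < K * (C / K) := mul_lt_mul_of_pos_left hst hKpos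
      _ = C := by field_simp

/-! ## The negative lemmas -/

/-- **An explicit non-flat poloidal Type-I profile with the frozen constraint, generic, and singular at the apex.**
Every hypothesis of the registered stub `stub_nonflatLiouville` except the Oseen-mild identity, plus three of the
genericity exclusions of the reshaped residue (not vertically rigid, `v·e₂` flat in no horizontal direction, not
scale-invariant), together with a backward singularity at the apex. [folklore] -/
theorem exists_nonflat_poloidal_frozen_typeI_singular_profile :
    ∃ (C : ℝ) (v : ℝ → EuclideanSpace ℝ (Fin 3) → EuclideanSpace ℝ (Fin 3)),
      HasTypeITimeDecay C v ∧
      ContinuousOn (Function.uncurry v) (Set.Iio (0 : ℝ) ×ˢ Set.univ) ∧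
      (∀ t < 0, VectorCalculus.IsDivFree (v t)) ∧
      (∀ s < 0, ∀ y, ⟪curl (v s) y, EuclideanSpace.single 2 1⟫_ℝ = 0) ∧
      (∀ s < 0, ∀ y, ⟪fderiv ℝ (v s) y (curl (v s) y), EuclideanSpace.single 2 1⟫_ℝ = 0) ∧
      (∃ s < 0, ∃ y, fderiv ℝ (v s) y (EuclideanSpace.single 0 1) 2 ≠ 0) ∧
      (∀ s < 0, ∃ y, fderiv ℝ (v s) y (EuclideanSpace.single 2 1) 0 ≠ 0) ∧
      (∀ s < 0, ∀ a : EuclideanSpace ℝ (Fin 3), a ≠ 0 → ⟪a, EuclideanSpace.single 2 1⟫_ℝ = 0 →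
        ∃ y, ⟪fderiv ℝ (v s) y a, EuclideanSpace.single 2 1⟫_ℝ ≠ 0) ∧
      (∃ lam : ℝ, 0 < lam ∧ ∃ s < 0, ∃ y : EuclideanSpace ℝ (Fin 3),
        lam • v (lam ^ 2 * s) (lam • y) ≠ v s y) ∧
      IsBackwardSingularPoint v 0 :=
  ⟨4, cellProfile, hasTypeITimeDecay_cellProfile, continuousOn_cellProfile, fun t _ => isDivFree_cellProfile t,
    fun s _ y => poloidal_cellProfile s y, fun s _ y => frozen_cellProfile s y,
    ⟨-1, by norm_num, _, nonflat_cellProfile⟩, fun s hs => ⟨_, not_vertRigid_cellProfile hs⟩,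
    fun s hs a ha ha2 => flat_in_no_horizontal_direction_cellProfile hs a ha ha2,
    ⟨2, two_pos, -1, by norm_num, _, not_scaleInvariant_cellProfile⟩, isBackwardSingularPoint_cellProfile⟩

/-- **The registered residue stub of K2 without the Oseen-mild identity is FALSE.** The statement below is VERBATIM
the hypothesis `h₅` of `…Theorems.PoloidalWindowDoorTarget.target_of_nonflatLiouville` /
`poloidalWindowRigidity_of_nonflatLiouville'` (= the registered signature of `stub_nonflatLiouville`) with its third
hypothesis (the unit-viscosity Oseen-mild identity) deleted; the cellular profile refutes it. So (M) is load-bearing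
on the NON-FLAT stratum too: poloidality, the frozen constraint and non-flatness are jointly satisfiable by singular
Type-I profiles. [folklore] -/
theorem stub_nonflatLiouville_false_without_mild :
    ¬ (∀ (C : ℝ) (v : ℝ → EuclideanSpace ℝ (Fin 3) → EuclideanSpace ℝ (Fin 3)),
        HasTypeITimeDecay C v →
        ContinuousOn (Function.uncurry v) (Set.Iio (0 : ℝ) ×ˢ Set.univ) →
        (∀ t < 0, VectorCalculus.IsDivFree (v t)) →
        (∀ s < 0, ∀ y, ⟪curl (v s) y, EuclideanSpace.single 2 1⟫_ℝ = 0) →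
        (∀ s < 0, ∀ y, ⟪fderiv ℝ (v s) y (curl (v s) y), EuclideanSpace.single 2 1⟫_ℝ = 0) →
        (∃ s < 0, ∃ y, fderiv ℝ (v s) y (EuclideanSpace.single 0 1) 2 ≠ 0) →
        ¬ IsBackwardSingularPoint v 0) := by
  intro h
  obtain ⟨C, v, hR, hC, hD, hP, hF, hN, -, -, -, hS⟩ := exists_nonflat_poloidal_frozen_typeI_singular_profile
  exact h C v hR hC hD hP hF hN hS

end Summit.NavierStokesRegularity.NavierStokesRegularity.Theorems.PoloidalWindowRigidity.Negative

end
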